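import Mathlib
import Literature.Analysis.FluidPDE.CompressibleEulerImplosionArrivalWindow2
import Summits.AtomisticToContinuum.HydrodynamicLimit.Theorems.ImplosionDichotomyDenseExcursionSonicPinnedProfileCentre

/-!
# The pinned BCG profile: sonic scale `c ∈ [17/50, 23/50]` and the certified centre expansion (d) on `x ≤ −1/3`
# (crux `DenseExcursion`, line `sonic-cavity-renewal`, brick `exists_pinnedProfile_centre_expansion` of stub `stub_boxPackage`)

Helper file (`--supports stmt-AtomisticToContinuum-12586`) for the registered stub `stub_boxPackage` of the line
`sonic-cavity-renewal` (crux `Summit.AtomisticToContinuum.HydrodynamicLimit.Theses.ImplosionDichotomy.DenseExcursion`).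
Re-run of `exists_pinnedProfile_centre` (`…SonicPinnedProfileCentre`) adding the UPPER bound of the sonic scale,
`c = e^{T₀} ≤ 23/50` — the sonic time `T₀` of the witness IS the arrival time `bT r` of the `P₀` trajectory (the orbit is the
trajectory before `T₀`, by uniqueness against the implicit system, and `D_Z` changes sign exactly there), which is bounded by
the phase-plane time estimate `Literature…ArrivalWindow2.exp_bT_le_window2` — and, as a consequence, CLAUSE (d) OF `CavityTube` ON
`x ≤ −1/3` FOR THE WITNESS: there `c·eˣ < 17/50`, so `W = Wser r c`, `S = Sser r c` (with their derivatives, the identification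
holding on an open set) and `centre_expansion_certified` (`Literature…CentreExpansionWindow2.centre_expansion_window2`, `c ∈ [1/3, 10/21]`)
applies with `W₂ = −w₃c²`, `s₀ = 1/(3c)`, `s₂ = w₂c/3`.

* `exists_pinnedProfile_centre_expansion` (registered) — all clauses of `exists_pinnedProfile_window2`, `17/50 ≤ c ≤ 23/50`, the series
  identification on `c eˣ < 17/50`, and `∃ W₂ s₀ s₂` with the bounds and the six inequalities of (d) for every `x ≤ −1/3`.

What is left for clause (d) of `CavityTube`: the near-sonic range `−1/3 < x ≤ 0` (outside the disc of the centre series).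

Sources: Buckmaster–Cao-Labora–Gómez-Serrano 2025, Thm 1.1, Prop. 2.5, Props. 2.2–2.3, Prop. 1.6, Prop. 4.1, §6.
-/

noncomputable section

open Set Filter Metric Topology
open scoped ContDiff

namespace Summit.AtomisticToContinuum.HydrodynamicLimit.Theorems.SonicCavityRenewal

open Literature.MathematicalPhysics.KineticTheory (V3)
open Literature.Analysis.FluidPDE.BuckmasterCaolaboraGomezserrano2025
open Literature.Analysis.FluidPDE.BuckmasterCaolaboraGomezserrano2025.OriginSeries
open Literature.Analysis.FluidPDE.BuckmasterCaolaboraGomezserrano2025.OriginSeries.CentreW2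
open Literature.Analysis.FluidPDE.BuckmasterCaolaboraGomezserrano2025.Monatomic
open Literature.Analysis.FluidPDE.BuckmasterCaolaboraGomezserrano2025.Monatomic.Germ
open Literature.Analysis.FluidPDE.BuckmasterCaolaboraGomezserrano2025.Monatomic.SonicSeries
open Summit.AtomisticToContinuum.HydrodynamicLimit.Theorems.R2OneModeTwoConditions
open Summit.AtomisticToContinuum.HydrodynamicLimit.Theorems.KidderKnobMelnikov
  (differentiableAt_of_radialScalar differentiableAt_of_radialField)

/-! ## The witness with its sonic scale and the series identification -/

/-- **Brick `exists_pinnedProfile_centre_expansion` of stub `stub_boxPackage` (line `sonic-cavity-renewal`): THE PINNED PROFILE,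
ITS SONIC SCALE AND ITS CERTIFIED CENTRE EXPANSION ON `x ≤ −1/3`.** There are a speed `r` in the shooting window
`[13890041/12500000, 697/625]`, a sonic scale `c ∈ [17/50, 23/50]` and a profile `(W, S)` with all the clauses of
`exists_pinnedProfile_window2` such that `W = Wser r c`, `S = Sser r c` wherever `c·eˣ < 17/50`, and clause (d) of `CavityTube` holds
for every `x ≤ −1/3` (`W₂ = −w₃c²`, `s₀ = 1/(3c)`, `s₂ = w₂c/3`).
[cite: BuckmasterCaolaboraGomezserrano2025, Thm 1.1, Prop. 2.5, Props. 2.2–2.3, Prop. 4.1, §6] -/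
theorem exists_pinnedProfile_centre_expansion : ∃ (r c : ℝ) (W S : ℝ → ℝ), ((13890041 / 12500000 : ℝ) ≤ r ∧ r ≤ 697 / 625) ∧ IsMonatomicProfile r W S ∧ OrigProfileEqs r W S ∧ W 0 + S 0 = 1 ∧ (∀ x, x < 0 → 1 < W x + S x) ∧ (∀ x, 0 < x → W x + S x < 1) ∧ deriv W 0 + deriv S 0 = -(2 - r - Real.sqrt (2 * (r - 1))) ∧ deriv W 0 + deriv S 0 ≤ -(2 / 5) ∧ W 0 = (r - Real.sqrt (r ^ 2 - 6 * r + 6)) / 2 ∧ AnalyticAt ℝ W 0 ∧ AnalyticAt ℝ S 0 ∧ (17 / 50 ≤ c ∧ c ≤ 23 / 50) ∧ (∀ x, c * Real.exp x < 17 / 50 → W x = OriginSeries.CentreW2.Wser r c x ∧ S x = OriginSeries.CentreW2.Sser r c x) ∧ ∃ W₂ s₀ s₂ : ℝ, |W₂| ≤ 1 / 10 ∧ 7 / 10 ≤ s₀ ∧ s₀ ≤ 1 ∧ |s₂| ≤ 1 / 10 ∧ ∀ x, x ≤ -(1 / 3) → |W x - (r - 1) - W₂ * Real.exp (2 * x)|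 ≤ 2 * Real.exp (4 * x) ∧ |deriv W x - 2 * W₂ * Real.exp (2 * x)| ≤ 2 * Real.exp (4 * x) ∧ |deriv (deriv W) x - 4 * W₂ * Real.exp (2 * x)| ≤ 2 * Real.exp (4 * x) ∧ |Real.exp x * S x - s₀ - s₂ * Real.exp (2 * x)| ≤ 2 * Real.exp (4 * x) ∧ |deriv (fun y => Real.exp y * S y) x - 2 * s₂ * Real.exp (2 * x)| ≤ 2 * Real.exp (4 * x) ∧ |deriv (deriv (fun y => Real.exp y * S y)) x - 4 * s₂ * Real.exp (2 * x)| ≤ 2 * Real.exp (4 * x) := by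
  obtain ⟨r, hr, Wo, Zo, T₀, hWo, hZo, heqo, hWZo, hlWo, hlZo, ⟨ε, hε, horigino⟩, hbWo, hbZo, hnego, hposo⟩ :=
    exists_meetingWZ_window2
  have hrQ : r ∈ Set.Icc ((13890041/12500000 : ℚ) : ℝ) ((697/625 : ℚ) : ℝ) := by
    refine ⟨?_, ?_⟩ <;> push_cast <;> linarith [hr.1, hr.2]
  have hr11 : (11 / 10 : ℝ) ≤ r := by linarith [hr.1]
  have hr28 : r ≤ 28 / 25 := by linarith [hr.2]
  -- the orbit is the `P₀` germ on the certified disc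
  have hWod : Differentiable ℝ Wo := hWo.differentiable (by simp)
  have hZod : Differentiable ℝ Zo := hZo.differentiable (by simp)
  have hgerm := orbit_eq_germ_window2 hrQ hWod hZod heqo hε horigino
  -- the orbit is the `P₀` trajectory before its arrival time
  obtain ⟨hA, hgermA, hodeT, hsigT, -, -, htendT⟩ := Shooting.traj_spec hr11 hr28
  have htraj : ∀ ξ, ξ < Shooting.bT r → Shooting.traj r ξ = (Wo ξ, Zo ξ) := by
    intro ξ hξ
    set a : ℝ := min (ξA - 2) (ξ - 1) with ha
    have ht₀ : ξA - 1 ∈ Ioo a (Shooting.bT r) := ⟨(min_le_left _ _).trans_lt (by linarith), hA⟩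
    have hagree : Shooting.traj r (ξA - 1) = (Wo (ξA - 1), Zo (ξA - 1)) := by
      rw [hgermA (ξA - 1) le_rfl]
      exact (hgerm (ξA - 1) ((exp_lt_of_le (show ξA - 1 ≤ ξA by norm_num)).trans (by norm_num))).symm
    have key := eqOn_of_field_implicit (r := r) ht₀ (fun t ht => hodeT t ht.2)
      (fun t ht => ⟨(hsigT t ht.2).1.ne', (hsigT t ht.2).2.1.ne⟩) hWod hZod heqo hagree
    exact key ⟨(min_le_right _ _).trans_lt (by linarith), hξ⟩
  -- the sonic time is the arrival time
  have h3 : r3 < r := lt_of_lt_of_le (by have := ShootingL.r3_lt_rlo; rwa [ShootingL.rlo_eq] at this) hr.1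
  have h4 : r < r4 := lt_of_le_of_lt hr.2 (by have := ShootingM.rhi_lt_r4; rwa [ShootingM.rhi_eq] at this)
  obtain ⟨hW0, hZ0, hW1, hZ1, hspec⟩ := sonicSeries_spec' h3 h4
  have hWoT : Wo T₀ = W0 r := by rw [hbWo.eq_of_nhds, sub_self, hW0]
  have hZoT : Zo T₀ = Z0 r := by rw [hbZo.eq_of_nhds, sub_self, hZ0]
  have hT₀ : T₀ = Shooting.bT r := by
    refine le_antisymm (le_of_not_gt fun hlt => ?_) (le_of_not_gt fun hlt => ?_)
    · -- `bT < T₀`: the orbit would reach `P_s` (where `D_Z = 0`) before `T₀`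
      have hcont : ContinuousAt (fun ξ => (Wo ξ, Zo ξ)) (Shooting.bT r) :=
        (hWod _).continuousAt.prodMk (hZod _).continuousAt
      have hlim : Tendsto (Shooting.traj r) (𝓝[<] Shooting.bT r) (𝓝 (Wo (Shooting.bT r), Zo (Shooting.bT r))) := by
        refine (hcont.tendsto.mono_left nhdsWithin_le_nhds).congr' ?_
        exact eventually_nhdsWithin_of_forall fun ξ hξ => (htraj ξ hξ).symm
      have heqP := tendsto_nhds_unique hlim htendT
      have hDZ := hnego (Shooting.bT r) hlt
      rw [show Wo (Shooting.bT r) = W0 r from congrArg Prod.fst heqP, show Zo (Shooting.bT r) = Z0 r from congrArg Prod.snd heqP,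
        DZ_Ps] at hDZ
      exact lt_irrefl _ hDZ
    · -- `T₀ < bT`: the trajectory would be at `P_s` before its arrival time
      have hDZ := (hsigT T₀ hlt).2.1
      rw [htraj T₀ hlt] at hDZ
      simp only at hDZ
      rw [hWoT, hZoT, DZ_Ps] at hDZ
      exact lt_irrefl _ hDZ
  -- the sonic scale `c = e^{T₀} ∈ [17/50, 23/50]`
  set c : ℝ := Real.exp T₀ with hc
  have hc0 : 0 < c := Real.exp_pos _
  have hcub : c ≤ 23 / 50 := by rw [hc, hT₀]; exact exp_bT_le_window2 hrQ
  have hclb : 17 / 50 ≤ c := by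
    refine le_of_not_gt fun hlt => ?_
    have hT : T₀ < Real.log (17 / 50) := by rw [Real.lt_log_iff_exp_lt (by norm_num)]; exact hlt
    set ξ₁ : ℝ := (T₀ + Real.log (17 / 50)) / 2 with hξ₁
    have h1 : T₀ < ξ₁ := by rw [hξ₁]; linarith
    have h2 : Real.exp ξ₁ < 17 / 50 := by
      rw [← Real.lt_log_iff_exp_lt (by norm_num), hξ₁]; linarith
    have hg := hgerm ξ₁ h2
    have hs := (germ_signs_window2 hrQ h2.le).2
    rw [← hg] at hs
    have hp := hposo ξ₁ h1
    simp only at hs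
    linarith
  -- the shifted orbit (adapted from `exists_sonicWZ_window2`)
  have hprof := originProfile_analytic (r := r) one_pos
  have hshift : Tendsto (fun x : ℝ => x + T₀) (𝓝 0) (𝓝 T₀) := by
    have h := (tendsto_id (x := 𝓝 (0 : ℝ))).add_const T₀
    simpa using h
  set Wc : ℝ → ℝ := fun x => Wo (x + T₀) with hWc
  set Zc : ℝ → ℝ := fun x => Zo (x + T₀) with hZc
  have hW : ContDiff ℝ ∞ Wc := hWo.comp (contDiff_id.add contDiff_const)
  have hZ : ContDiff ℝ ∞ Zc := hZo.comp (contDiff_id.add contDiff_const)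
  have heq : ∀ ξ, DW (Wc ξ) (Zc ξ) * deriv Wc ξ = NW r (Wc ξ) (Zc ξ) ∧ DZ (Wc ξ) (Zc ξ) * deriv Zc ξ = NZ r (Wc ξ) (Zc ξ) := by
    intro ξ
    simp only [hWc, hZc]
    rw [deriv_comp_add_const, deriv_comp_add_const]; exact heqo _
  have hWZ : ∀ ξ, Zc ξ < Wc ξ := fun ξ => hWZo _
  have hlW : Tendsto Wc atTop (𝓝 0) := hlWo.comp (tendsto_atTop_add_const_right _ T₀ tendsto_id)
  have hlZ : Tendsto Zc atTop (𝓝 0) := hlZo.comp (tendsto_atTop_add_const_right _ T₀ tendsto_id)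
  set g : ℝ → ℝ := fun ζ => c⁻¹ * OriginSeries.profile r 1 (c * ζ) with hgdef
  have hg : AnalyticAt ℝ g 0 := by
    refine analyticAt_const.mul (hprof.1.comp_of_eq ?_ (by simp))
    exact analyticAt_const.mul analyticAt_id
  have hg0 : 0 < g 0 := by simp only [hgdef, mul_zero, hprof.2]; positivity
  have horigin : ∀ ζ ∈ Ioo 0 (c⁻¹ * ε), ζ * Wc (Real.log ζ) = g ζ ∧ -ζ * Zc (Real.log ζ) = g (-ζ) := by
    intro ζ hζ
    obtain ⟨hζ0, hζε⟩ := hζ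
    have hcζ : c * ζ ∈ Ioo 0 ε := ⟨by positivity, by rwa [lt_inv_mul_iff₀ hc0] at hζε⟩
    obtain ⟨h1, h2⟩ := horigino (c * ζ) hcζ
    have hlog : Real.log ζ + T₀ = Real.log (c * ζ) := by
      rw [Real.log_mul hc0.ne' hζ0.ne', hc, Real.log_exp]; ring
    simp only [hWc, hZc, hgdef]
    rw [hlog, show c * -ζ = -(c * ζ) by ring, ← h1, ← h2]
    constructor <;> field_simp
  have hbW : Wc =ᶠ[𝓝 0] Wloc r := by
    have h := hbWo.comp_tendsto hshift
    refine h.trans (Eventually.of_forall fun x => ?_)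
    simp
  have hbZ : Zc =ᶠ[𝓝 0] Zloc r := by
    have h := hbZo.comp_tendsto hshift
    refine h.trans (Eventually.of_forall fun x => ?_)
    simp
  have hneg : ∀ ξ, ξ < 0 → DZ (Wc ξ) (Zc ξ) < 0 := fun ξ hξ => hnego _ (by linarith)
  have hpos : ∀ ξ, 0 < ξ → 0 < DZ (Wc ξ) (Zc ξ) := fun ξ hξ => hposo _ (by linarith)
  -- the profile (adapted from `exists_pinnedProfile_window2`)
  have hr₃ : 1.10102 < r := by norm_num at hr ⊢; linarith [hr.1]
  have hr₄ : r < 1.13476 := by norm_num at hr ⊢; linarith [hr.2]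
  have hrκ : r ≤ 279 / 250 := by norm_num at hr ⊢; linarith [hr.2]
  obtain ⟨U, S, hU3, hS3, hode, hSpos, hUinf, hSinf, hdict⟩ :=
    profileData_of_WZ hW hZ heq hWZ hlW hlZ hg hg0 (by positivity : 0 < c⁻¹ * ε) horigin
  have hWf : wOf U = fun x => -(Wc x + Zc x) / 2 := funext fun x => (hdict x).1
  have hSf : sOf S = fun x => (Wc x - Zc x) / 6 := funext fun x => (hdict x).2
  have hsum : ∀ x, wOf U x + sOf S x = 1 - DZ (Wc x) (Zc x) := fun x => by
    rw [(hdict x).1, (hdict x).2]; unfold DZ; ring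
  have hρ : |(0 : ℝ)| < sonicRad r := by rw [abs_zero]; exact sonicRad_pos (h4.trans r3_r4_mem.2.2)
  obtain ⟨hanW, hanZ, -, -⟩ := hspec 0 hρ
  have hWc0 : Wc 0 = W0 r := by rw [hbW.eq_of_nhds, hW0]
  have hZc0 : Zc 0 = Z0 r := by rw [hbZ.eq_of_nhds, hZ0]
  have hdWc : deriv Wc 0 = W1 r := by rw [hbW.deriv_eq, hW1]
  have hdZc : deriv Zc 0 = Z1 r := by rw [hbZ.deriv_eq, hZ1]
  have hWd : Differentiable ℝ Wc := hW.differentiable (by simp)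
  have hZd : Differentiable ℝ Zc := hZ.differentiable (by simp)
  have hκ' : deriv (wOf U) 0 + deriv (sOf S) 0 = -(2 - r - Real.sqrt (2 * (r - 1))) := by
    have hdW : deriv (wOf U) 0 = -(deriv Wc 0 + deriv Zc 0) / 2 := by
      rw [hWf]
      exact (((hWd 0).hasDerivAt.add (hZd 0).hasDerivAt).neg.div_const 2).deriv
    have hdS : deriv (sOf S) 0 = (deriv Wc 0 - deriv Zc 0) / 6 := by
      rw [hSf]
      exact (((hWd 0).hasDerivAt.sub (hZd 0).hasDerivAt).div_const 6).deriv
    rw [hdW, hdS, hdWc, hdZc]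
    unfold W1 Z1 Monatomic.p
    ring
  -- the identification with the centre series on `c e^x < 17/50`
  have hident : ∀ x, c * Real.exp x < 17 / 50 → wOf U x = Wser r c x ∧ sOf S x = Sser r c x := by
    intro x hx
    have hexp : Real.exp (x + T₀) = c * Real.exp x := by rw [Real.exp_add, hc]; ring
    have hlt : Real.exp (x + T₀) < 17 / 50 := by rw [hexp]; exact hx
    have hg' := hgerm (x + T₀) hlt
    have hWx : Wc x = (germ r (x + T₀)).1 := by simp only [hWc]; rw [← hg']
    have hZx : Zc x = (germ r (x + T₀)).2 := by simp only [hZc]; rw [← hg']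
    rw [germ_fst] at hWx
    rw [germ_snd] at hZx
    have hE : Real.exp (-(x + T₀)) = (c * Real.exp x)⁻¹ := by rw [Real.exp_neg, hexp]
    rw [hE, hexp] at hWx hZx
    have hμx : (73 / 25 : ℝ) * (c * Real.exp x) < 1 := by nlinarith [Real.exp_pos x]
    have hζ0 : 0 < c * Real.exp x := by positivity
    constructor
    · rw [(hdict x).1, Wser_eq_profile hrQ hc0 hμx, hWx, hZx]
      field_simp
      ring
    · rw [(hdict x).2]
      have hS := exp_mul_Sser_eq_profile hrQ hc0 hμx
      have hex : Real.exp x ≠ 0 := (Real.exp_pos x).ne'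
      have : Sser r c x = (profile r 1 (c * Real.exp x) + profile r 1 (-(c * Real.exp x))) / (6 * c) / Real.exp x := by
        rw [← hS]; field_simp
      rw [this, hWx, hZx]
      field_simp
      ring
  -- clause (d) on `x ≤ -1/3`: transport from the series profile
  have hUopen : IsOpen {y : ℝ | c * Real.exp y < 17 / 50} :=
    isOpen_lt (continuous_const.mul Real.continuous_exp) continuous_const
  have hthird : ∀ x : ℝ, x ≤ -(1 / 3) → c * Real.exp x < 17 / 50 := by
    intro x hx
    have h1 : Real.exp x ≤ 7169 / 10000 := (Real.exp_le_exp.mpr hx).trans exp_neg_third_le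
    nlinarith [Real.exp_pos x]
  have hWev : ∀ x : ℝ, c * Real.exp x < 17 / 50 → wOf U =ᶠ[𝓝 x] Wser r c := fun x hx => by
    filter_upwards [hUopen.mem_nhds hx] with y hy using (hident y hy).1
  have hSev : ∀ x : ℝ, c * Real.exp x < 17 / 50 → (fun y => Real.exp y * sOf S y) =ᶠ[𝓝 x] (fun y => Real.exp y * Sser r c y) :=
    fun x hx => by
    filter_upwards [hUopen.mem_nhds hx] with y hy
    rw [(hident y hy).2]
  have hdWev : ∀ x : ℝ, c * Real.exp x < 17 / 50 → deriv (wOf U) =ᶠ[𝓝 x] deriv (Wser r c) := fun x hx => by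
    filter_upwards [hUopen.mem_nhds hx] with y hy using (hWev y hy).deriv_eq
  have hdSev : ∀ x : ℝ, c * Real.exp x < 17 / 50 →
      deriv (fun y => Real.exp y * sOf S y) =ᶠ[𝓝 x] deriv (fun y => Real.exp y * Sser r c y) := fun x hx => by
    filter_upwards [hUopen.mem_nhds hx] with y hy using (hSev y hy).deriv_eq
  obtain ⟨hW2, hs0a, hs0b, hs2, hsix⟩ := centre_expansion_window2 hrQ (c := c) ⟨by linarith, by linarith⟩
  refine ⟨r, c, wOf U, sOf S, hr, isMonatomicProfile_wOf_sOf hr₃ hr₄ hU3 hS3 hode hSpos hUinf hSinf, fun x => ?_, ?_,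
    fun x hx => ?_, fun x hx => ?_, hκ', ?_, ?_, ?_, ?_, ⟨hclb, hcub⟩, hident,
    -(OriginSeries.w r 1 3) * c ^ 2, 1 / (3 * c), OriginSeries.w r 1 2 * c / 3, hW2, hs0a, hs0b, hs2, fun x hx => ?_⟩
  · -- the equations in original form
    have hζ : 0 < Real.exp x := Real.exp_pos x
    obtain ⟨h1, h2⟩ := hode (Real.exp x) hζ
    exact origProfileEqs_of_bcg (differentiableAt_of_radialField hU3 hζ) (differentiableAt_of_radialScalar hS3 hζ) h1 h2
  · -- `W 0 + S 0 = 1`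
    rw [hsum, hWc0, hZc0, DZ_Ps]; ring
  · -- `x < 0`: `D_Z < 0`
    rw [hsum]; linarith [hneg x hx]
  · -- `x > 0`: `D_Z > 0`
    rw [hsum]; linarith [hpos x hx]
  · -- `κ(r) ≥ 2/5` on the narrowed window
    rw [hκ']
    linarith [kappa_ge_two_fifths hrκ]
  · -- the sonic value `W(0) = (r - q)/2`
    rw [(hdict 0).1, hWc0, hZc0]
    unfold W0 Z0 Monatomic.q disc
    ring
  · -- analyticity at the sonic point
    rw [hWf]
    exact ((hanW.congr hbW.symm).add (hanZ.congr hbZ.symm)).neg.div_const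
  · rw [hSf]
    exact ((hanW.congr hbW.symm).sub (hanZ.congr hbZ.symm)).div_const
  · -- clause (d) at `x ≤ -1/3`
    have hxU := hthird x hx
    obtain ⟨d1, d2, d3, d4, d5, d6⟩ := hsix x hx
    have e4 : Real.exp x * sOf S x = Real.exp x * Sser r c x := (hSev x hxU).eq_of_nhds
    rw [(hWev x hxU).eq_of_nhds, (hWev x hxU).deriv_eq, (hdWev x hxU).deriv_eq, (hSev x hxU).deriv_eq, (hdSev x hxU).deriv_eq]
    rw [e4]
    exact ⟨d1, d2, d3, d4, d5, d6⟩

end Summit.AtomisticToContinuum.HydrodynamicLimit.Theorems.SonicCavityRenewal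

end
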